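import Summits.AnomalousDissipation.AnomalousDissipation.Theses.LandauJetArena
import Literature.Analysis.FluidPDE.DoeringFoiasProofs
import Literature.Analysis.FluidPDE.DoeringFoiasPowerProofs
import Literature.Analysis.FluidPDE.LongTimeAverageNonneg

/-!
# Crux `LandauJetArena.JetPairZerothLaw` (stmt-AnomalousDissipation-1540) — the strategist's SEAM, by name

Crux-strategist decomposition (BC2 redirect) of the route target
`X = Summit.AnomalousDissipation.AnomalousDissipation.Theses.LandauJetArena.JetPairZerothLaw`
(the zeroth law restricted to push–pull jet-pair forces) into TWO pieces, neither of which is the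
crux or the summit, with the assembly PROVED:

* `Seam.JetPairWorkFloor` — **∀-piece, input-power floor at zero momentum.** For every jet-pair
  force `f` (the route's class, verbatim) and every energy level `E` there are `ε > 0`, `ν₀ > 0`
  such that EVERY global Leray–Hopf solution with viscosity `0 < ν ≤ ν₀`, zero-momentum datum
  (`Torus.HasZeroMean u₀`; the mean flow is conserved, `Torus.IsGlobalLerayHopf.integral_inner_const_eq`)
  and limsup-mean energy `≤ E` receives limsup-mean input power `⟨∫⟪f, u⟫⟩ ≥ ε`
  (`= Literature.Analysis.FluidPDE.meanPower f u`, written out so that the route module needs no import).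
* `Seam.JetPairNoLeakFamily` — **∃-piece, bounded no-leak family.** For SOME jet-pair force there are
  `E`, `θ > 0` and a vanishing-viscosity family of global Leray–Hopf solutions from zero-momentum data
  with limsup-mean energies `≤ E` whose resolved dissipation keeps the fraction `θ` of the input
  power: `θ ⟨∫⟪f, u_j⟫⟩ ≤ ν_j⟨‖∇u_j‖²⟩` for every `j`.

Kernel-checked here (no `sorry`):
* `jetPairZerothLaw_of_pieces : JetPairWorkFloor → JetPairNoLeakFamily → JetPairZerothLaw` — THE GLUE
  (reindex the family past `ν₀(E)`; then `θ ε ≤ θ · power ≤ dissipation`);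
* `jetPairWorkFloor_of_dissipationFloor : JetPairDissipationFloor → JetPairWorkFloor` — the ∀-piece is
  IMPLIED BY the route's filed rank-2 crux (stmt-1542), via the Leray–Hopf power balance
  `⟨ν‖∇u‖²⟩ ≤ ⟨f·u⟩` (`DoeringFoias2002_dissipation_le_power_holds`, in tree): strictly better-hedged leaf;
* `jetPairNoLeakFamily_of_zerothLawZM : JetPairZerothLawZM → JetPairNoLeakFamily` and
  `jetPairZerothLaw_of_zerothLawZM : JetPairZerothLawZM → JetPairZerothLaw`, where `JetPairZerothLawZM` is
  the crux with zero-momentum data: the ∃-piece is NO STRONGER than the (zero-momentum) crux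
  (`θ = ε/(‖f‖₂√(max E 0) + 1)` by the Doering–Foias power bound `⟨f·u⟩ ≤ ‖f‖₂ U`,
  `Torus.IsGlobalLerayHopf.meanPower_le`, in tree).

So the seam is exact up to the zero-momentum normalisation:
`JetPairDissipationFloor ⇒ WorkFloor`, `WorkFloor ∧ NoLeakFamily ⇒ X`, `X_ZM ⇒ X`, `X_ZM ⇒ NoLeakFamily`.
The frame form of the glue (bodies inlined, importable by the route module) is `Split.lean` next to this file.
-/

-- crux-workfile namespace (the route namespace is the gate's; children are rendered there by `route edit --split`)
namespace Summit.AnomalousDissipation.AnomalousDissipation.Cruxes.JetPairZerothLaw.Seam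

set_option linter.dupNamespace false

open Filter Topology MeasureTheory
open Literature.Analysis.FluidPDE
open Summit.AnomalousDissipation.AnomalousDissipation.Theses.LandauJetArena
  (JetPairZerothLaw JetPairDissipationFloor)

/-- ∀-piece (child 1 of the split): input-power floor for zero-momentum bounded Leray–Hopf solutions
driven by a jet pair. -/
def JetPairWorkFloor : Prop :=
  ∀ (ρ : ℝ) (a : UnitAddTorus (Fin 3)) (φ : UnitAddTorus (Fin 3) → ℝ) (f : UnitAddTorus (Fin 3) → EuclideanSpace ℝ (Fin 3)), (0 < ρ ∧ 4 * ρ < ‖a + a‖ ∧ Literature.Analysis.FunctionSpaces.Torus.IsSmooth φ ∧ (∀ x, 0 ≤ φ x) ∧ (∀ x : UnitAddTorus (Fin 3), ρ ≤ ‖x‖ → φ x = 0) ∧ MeasureTheory.integral MeasureTheory.volume (fun x => φ x) = 1 ∧ Literature.Analysis.FunctionSpaces.Torus.IsSmooth f ∧ Literature.Analysis.FunctionSpaces.Torus.IsDivFree f ∧ Literature.Analysis.FunctionSpaces.Torus.HasZeroMean f ∧ (∀ w : UnitAddTorus (Fin 3) → EuclideanSpace ℝ (Fin 3), Literature.Analysis.FunctionSpaces.Torus.IsSmooth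 w → Literature.Analysis.FunctionSpaces.Torus.IsDivFree w → MeasureTheory.integral MeasureTheory.volume (fun x => inner ℝ (f x) (w x)) = MeasureTheory.integral MeasureTheory.volume (fun x => (φ (x - a) - φ (x + a)) * inner ℝ (w x) (EuclideanSpace.single (2 : Fin 3) (1 : ℝ) : EuclideanSpace ℝ (Fin 3))))) → ∀ E : ℝ, ∃ ε : ℝ, 0 < ε ∧ ∃ ν₀ : ℝ, 0 < ν₀ ∧ ∀ (ν : ℝ) (u₀ : UnitAddTorus (Fin 3) → EuclideanSpace ℝ (Fin 3)) (u : ℝ → UnitAddTorus (Fin 3) → EuclideanSpace ℝ (Fin 3)), 0 < ν → ν ≤ ν₀ → Literature.Analysis.FunctionSpaces.Torus.HasZeroMean u₀ → Literature.Analysis.FluidPDE.Torus.IsGlobalLerayHopf ν (fun _ => f) u₀ u → Literature.Analysis.FluidPDE.meanEnergy u ≤ E → ε ≤ Literature.Analysis.FluidPDE.longTimeAvgSup (fun t => MeasureTheory.integral MeasureTheory.volume (fun x => inner ℝ (f x) (u t x)))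

/-- ∃-piece (child 2 of the split): a bounded-energy, zero-momentum, no-leak vanishing-viscosity
family for some jet pair. -/
def JetPairNoLeakFamily : Prop :=
  ∃ (ρ : ℝ) (a : UnitAddTorus (Fin 3)) (φ : UnitAddTorus (Fin 3) → ℝ) (f : UnitAddTorus (Fin 3) → EuclideanSpace ℝ (Fin 3)), (0 < ρ ∧ 4 * ρ < ‖a + a‖ ∧ Literature.Analysis.FunctionSpaces.Torus.IsSmooth φ ∧ (∀ x, 0 ≤ φ x) ∧ (∀ x : UnitAddTorus (Fin 3), ρ ≤ ‖x‖ → φ x = 0) ∧ MeasureTheory.integral MeasureTheory.volume (fun x => φ x) = 1 ∧ Literature.Analysis.FunctionSpaces.Torus.IsSmooth f ∧ Literature.Analysis.FunctionSpaces.Torus.IsDivFree f ∧ Literature.Analysis.FunctionSpaces.Torus.HasZeroMean f ∧ (∀ w : UnitAddTorus (Fin 3) → EuclideanSpace ℝ (Fin 3), Literature.Analysis.FunctionSpaces.Torus.IsSmooth w → Literature.Analysis.FunctionSpaces.Torus.IsDivFree w → MeasureTheory.integral MeasureTheory.volume (fun x => inner ℝ (f x) (w x)) = MeasureTheory.integral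 MeasureTheory.volume (fun x => (φ (x - a) - φ (x + a)) * inner ℝ (w x) (EuclideanSpace.single (2 : Fin 3) (1 : ℝ) : EuclideanSpace ℝ (Fin 3))))) ∧ ∃ (E θ : ℝ) (ν : ℕ → ℝ) (u₀ : ℕ → UnitAddTorus (Fin 3) → EuclideanSpace ℝ (Fin 3)) (u : ℕ → ℝ → UnitAddTorus (Fin 3) → EuclideanSpace ℝ (Fin 3)), 0 < θ ∧ (∀ j, 0 < ν j) ∧ Filter.Tendsto ν Filter.atTop (nhds 0) ∧ (∀ j, Literature.Analysis.FunctionSpaces.Torus.HasZeroMean (u₀ j)) ∧ (∀ j, Literature.Analysis.FluidPDE.Torus.IsGlobalLerayHopf (ν j) (fun _ => f) (u₀ j) (u j)) ∧ (∀ j, Literature.Analysis.FluidPDE.meanEnergy (u j) ≤ E) ∧ ∀ j, θ * Literature.Analysis.FluidPDE.longTimeAvgSup (fun t => MeasureTheory.integral MeasureTheory.volume (fun x => inner ℝ (f x) (u j t x))) ≤ Literature.Analysis.FluidPDE.meanDissipation (ν j) (u j)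

/-- The crux with zero-momentum data (normal form; used only to position the ∃-piece). -/
def JetPairZerothLawZM : Prop :=
  ∃ (ρ : ℝ) (a : UnitAddTorus (Fin 3)) (φ : UnitAddTorus (Fin 3) → ℝ) (f : UnitAddTorus (Fin 3) → EuclideanSpace ℝ (Fin 3)), (0 < ρ ∧ 4 * ρ < ‖a + a‖ ∧ Literature.Analysis.FunctionSpaces.Torus.IsSmooth φ ∧ (∀ x, 0 ≤ φ x) ∧ (∀ x : UnitAddTorus (Fin 3), ρ ≤ ‖x‖ → φ x = 0) ∧ MeasureTheory.integral MeasureTheory.volume (fun x => φ x) = 1 ∧ Literature.Analysis.FunctionSpaces.Torus.IsSmooth f ∧ Literature.Analysis.FunctionSpaces.Torus.IsDivFree f ∧ Literature.Analysis.FunctionSpaces.Torus.HasZeroMean f ∧ (∀ w : UnitAddTorus (Fin 3) → EuclideanSpace ℝ (Fin 3), Literature.Analysis.FunctionSpaces.Torus.IsSmooth w → Literature.Analysis.FunctionSpaces.Torus.IsDivFree w → MeasureTheory.integral MeasureTheory.volume (fun x => inner ℝ (f x) (w x)) = MeasureTheory.integral MeasureTheory.volume (fun x => (φ (x - a) - φ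 (x + a)) * inner ℝ (w x) (EuclideanSpace.single (2 : Fin 3) (1 : ℝ) : EuclideanSpace ℝ (Fin 3))))) ∧ ∃ (ν : ℕ → ℝ) (u₀ : ℕ → UnitAddTorus (Fin 3) → EuclideanSpace ℝ (Fin 3)) (u : ℕ → ℝ → UnitAddTorus (Fin 3) → EuclideanSpace ℝ (Fin 3)), (∀ j, 0 < ν j) ∧ Filter.Tendsto ν Filter.atTop (nhds 0) ∧ (∀ j, Literature.Analysis.FunctionSpaces.Torus.HasZeroMean (u₀ j)) ∧ (∀ j, Literature.Analysis.FluidPDE.Torus.IsGlobalLerayHopf (ν j) (fun _ => f) (u₀ j) (u j)) ∧ (∃ E : ℝ, ∀ j, Literature.Analysis.FluidPDE.meanEnergy (u j) ≤ E) ∧ ∃ ε : ℝ, 0 < ε ∧ ∀ j, ε ≤ Literature.Analysis.FluidPDE.meanDissipation (ν j) (u j)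

/-- **THE GLUE of the split.** `JetPairWorkFloor → JetPairNoLeakFamily → JetPairZerothLaw`:
take the configuration, `E`, `θ` and the family from the ∃-piece; the ∀-piece at that configuration
and `E` gives `ε > 0`, `ν₀ > 0`; `ν j → 0` gives `J` with `ν j ≤ ν₀` for `j ≥ J`; reindex `j ↦ j + J`
(still a vanishing-viscosity Leray–Hopf family for `f` with energies `≤ E`); for each member the
floor gives `ε ≤ ⟨f·u⟩` and the no-leak clause `θ⟨f·u⟩ ≤ ν⟨‖∇u‖²⟩`, so `θ ε` is a dissipation
floor. [folklore] -/
theorem jetPairZerothLaw_of_pieces : JetPairWorkFloor → JetPairNoLeakFamily → JetPairZerothLaw := by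
  intro hFloor hFam
  obtain ⟨ρ, a, φ, f, hcfg, E, θ, ν, u₀, u, hθ, hν, hT, hzm, hLH, hE, hNL⟩ := hFam
  obtain ⟨ε, hε, ν₀, hν₀, hfl⟩ := hFloor ρ a φ f hcfg E
  obtain ⟨J, hJ⟩ := eventually_atTop.1 (hT.eventually (Iic_mem_nhds hν₀))
  refine ⟨ρ, a, φ, f, hcfg, fun j => ν (j + J), fun j => u₀ (j + J), fun j => u (j + J),
    fun j => hν (j + J), hT.comp (tendsto_add_atTop_nat J), fun j => hLH (j + J),
    ⟨E, fun j => hE (j + J)⟩, θ * ε, mul_pos hθ hε, fun j => ?_⟩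
  have hw : ε ≤ longTimeAvgSup (fun t => ∫ x, inner ℝ (f x) (u (j + J) t x)) :=
    hfl (ν (j + J)) (u₀ (j + J)) (u (j + J)) (hν (j + J)) (hJ (j + J) (Nat.le_add_left J j))
      (hzm (j + J)) (hLH (j + J)) (hE (j + J))
  calc θ * ε ≤ θ * longTimeAvgSup (fun t => ∫ x, inner ℝ (f x) (u (j + J) t x)) :=
        mul_le_mul_of_nonneg_left hw hθ.le
    _ ≤ meanDissipation (ν (j + J)) (u (j + J)) := hNL (j + J)

/-- End to end: the two pieces decide the summit through the route's certified `closes`. [folklore] -/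
example (h₁ : JetPairWorkFloor) (h₂ : JetPairNoLeakFamily) : _root_.AnomalousDissipation :=
  Summit.AnomalousDissipation.AnomalousDissipation.Theses.LandauJetArena.closes (jetPairZerothLaw_of_pieces h₁ h₂)

/-- **The ∀-piece is implied by the filed rank-2 crux** `JetPairDissipationFloor` (stmt-1542): a floor
on the resolved dissipation is a floor on the input power, by the Leray–Hopf power balance
`⟨ν‖∇u‖²⟩ ≤ ⟨f·u⟩` (`DoeringFoias2002_dissipation_le_power_holds`); the zero-momentum hypothesis is
simply not used. [folklore] -/
theorem jetPairWorkFloor_of_dissipationFloor : JetPairDissipationFloor → JetPairWorkFloor := by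
  intro hFloor ρ a φ f hcfg E
  obtain ⟨ε, hε, ν₀, hν₀, hfl⟩ := hFloor ρ a φ f hcfg E
  obtain ⟨-, -, -, -, -, -, hfs, -, hfm, -⟩ := hcfg
  refine ⟨ε, hε, ν₀, hν₀, fun ν u₀ u hν hνle _hzm hLH hEle => ?_⟩
  have h1 : ε ≤ meanDissipation ν u := hfl ν u₀ u hν hνle hLH hEle
  have h2 : meanDissipation ν u ≤ meanPower f u :=
    DoeringFoias2002_dissipation_le_power_holds hν (hfs.memLp 2) hfm u₀ u hLH
  exact h1.trans h2

/-- Forgetting the zero-momentum clause. [folklore] -/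
theorem jetPairZerothLaw_of_zerothLawZM : JetPairZerothLawZM → JetPairZerothLaw := by
  rintro ⟨ρ, a, φ, f, hcfg, ν, u₀, u, hν, hT, -, hLH, hE, ε, hε, hD⟩
  exact ⟨ρ, a, φ, f, hcfg, ν, u₀, u, hν, hT, hLH, hE, ε, hε, hD⟩

/-- **The ∃-piece is no stronger than the zero-momentum crux**: a zero-momentum bounded family with a
dissipation floor `ε` is a no-leak family with `θ = ε/(‖f‖₂ √(max E 0) + 1)`, because the input power
is bounded ABOVE by the Doering–Foias estimate `⟨f·u⟩ ≤ ‖f‖₂ U ≤ ‖f‖₂ √E`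
(`Torus.IsGlobalLerayHopf.meanPower_le`). [folklore] -/
theorem jetPairNoLeakFamily_of_zerothLawZM : JetPairZerothLawZM → JetPairNoLeakFamily := by
  rintro ⟨ρ, a, φ, f, hcfg, ν, u₀, u, hν, hT, hzm, hLH, ⟨E, hE⟩, ε, hε, hD⟩
  have hcfg' := hcfg
  obtain ⟨-, -, -, -, -, -, hfs, -, hfm, -⟩ := hcfg'
  set W : ℝ := Real.sqrt (∫ x, ‖f x‖ ^ 2) * Real.sqrt (max E 0) with hWdef
  have hW0 : 0 ≤ W := mul_nonneg (Real.sqrt_nonneg _) (Real.sqrt_nonneg _)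
  have hθ : 0 < ε / (W + 1) := div_pos hε (by linarith)
  refine ⟨ρ, a, φ, f, hcfg, E, ε / (W + 1), ν, u₀, u, hθ, hν, hT, hzm, hLH, hE, fun j => ?_⟩
  have hP : meanPower f (u j) ≤ W := by
    have h := Torus.IsGlobalLerayHopf.meanPower_le (hν j) hfs hfm (hLH j)
    have hr : rmsVelocity longTimeAvgSup (u j) ≤ Real.sqrt (max E 0) := by
      rw [rmsVelocity_eq_sqrt_meanEnergy]
      exact Real.sqrt_le_sqrt ((hE j).trans (le_max_left _ _))
    exact h.trans (mul_le_mul_of_nonneg_left hr (Real.sqrt_nonneg _))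
  show ε / (W + 1) * meanPower f (u j) ≤ meanDissipation (ν j) (u j)
  calc ε / (W + 1) * meanPower f (u j) ≤ ε / (W + 1) * W := mul_le_mul_of_nonneg_left hP hθ.le
    _ ≤ ε := by
        rw [div_mul_eq_mul_div, div_le_iff₀ (by linarith)]
        nlinarith
    _ ≤ meanDissipation (ν j) (u j) := hD j

end Summit.AnomalousDissipation.AnomalousDissipation.Cruxes.JetPairZerothLaw.Seam
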